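import Summits.ValiantsHypothesis.ValiantsHypothesis.Theorems.DivisionGapPerDivisionHardStubDescent
import Summits.ValiantsHypothesis.ValiantsHypothesis.Theorems.DivisionGapPerDivisionHardStubBlockSubstFacePer

/-!
# Crux `DivisionGap.PerDivisionHard` (stmt-ValiantsHypothesis-5065), line
`pair-descent-jss-endpoint` — stub `stub_descentAt` (descent across scales, explicit cofactor)

`stub_descent` (`…StubDescent.lean`) restated for the EXPLICIT projected cofactor
`h♭ = aeval (blockSubst eR eC) (top_w h)` — the witness of the landed proof — with the phase
projection of the placed face permanent already rewritten to `per_b`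
(`stub_blockSubstFacePer`).  For a placement `eR eC : BlockV b k m ≃ Fin n`, a weight `w` cutting
out the placed face `G = placedBlock eR eC` and a nonzero cofactor `h ∈ ℝ≥0[x_ij]`:

* `h♭ ≠ 0` — over `ℝ≥0` nothing cancels: the projection sends the monomial `c x^d` to the monomial
  `c x^{Φ d}`;
* `L(per_b · h♭) ≤ L(per_n · h)` — `per_b · h♭ = P(per_G) · h♭ = P(top_w(per_n · h))`
  (`stub_blockSubstFacePer`, `map_mul`, `topComponent_mul`, `topComponent_perPoly_eq_facePer`),
  projections are free (`complexity_le_of_isProjection`, `isProjection_blockSubst`) and initial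
  forms are free (`complexity_topComponent_le`);
* `L(h♭) ≤ L(h)` — the same two free moves;
* `|supp h♭| ≤ |supp (top_w h)|` — `supp h♭ ⊆ Φ '' supp (top_w h)`.
-/

noncomputable section

-- `Summit.ValiantsHypothesis.ValiantsHypothesis.…` is the tree's mandated single-conjunct layout
-- (Sub = Summit), so the duplicated namespace component is intended.
set_option linter.dupNamespace false

namespace Summit.ValiantsHypothesis.ValiantsHypothesis.Theorems.DivisionGapPerDivisionHard

open MvPolynomial Literature.Computability.AlgebraicComplexity
open Summit.ValiantsHypothesis.ValiantsHypothesis.Theorems.ZeroOneTransfer.Negative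
open scoped NNReal

variable {b k m n : ℕ}

/-! ### The phase projection on monomials -/

/-- Every value of `blockSubst` is a monic monomial (`X _` or `1`). [folklore] -/
private theorem exists_blockSubst_eq_monomial_at (eR eC : BlockV b k m ≃ Fin n)
    (e : Fin n × Fin n) :
    ∃ s : (Fin b × Fin b) →₀ ℕ, blockSubst eR eC e = monomial s 1 := by
  unfold blockSubst
  rcases eR.symm e.1 with i | y
  · exact ⟨Finsupp.single (i, phaseIdx i (eC.symm e.2)) 1, rfl⟩
  · refine ⟨0, ?_⟩
    rw [← C_apply, C_1]
    rfl

/-- Under a substitution by monic monomials, the monomial `c x^d` goes to the monomial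
`c x^{Σ_i d_i • s_i}`. [folklore] -/
private theorem aeval_monomial_eq_monomial_at {σ τ R : Type*} [CommSemiring R]
    {a : σ → MvPolynomial τ R} {s : σ → τ →₀ ℕ} (hs : ∀ i, a i = monomial (s i) 1)
    (d : σ →₀ ℕ) (c : R) :
    aeval a (monomial d c) = monomial (∑ i ∈ d.support, d i • s i) c := by
  rw [aeval_monomial, algebraMap_eq, Finsupp.prod, monomial_sum_index]
  congr 1
  refine Finset.prod_congr rfl fun i _ => ?_
  rw [hs i, monomial_pow, one_pow]

/-! ### The stub -/

/-- **`stub_descentAt` (descent across scales for the explicit projected cofactor, line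
`pair-descent-jss-endpoint`).**  If `w` cuts out the placed face `G = placedBlock eR eC` and
`h ≠ 0`, then the explicit cofactor `h♭ = P(top_w h)`, `P` the phase projection
`aeval (blockSubst eR eC)`, satisfies `h♭ ≠ 0`, `L(per_b · h♭) ≤ L(per_n · h)`, `L(h♭) ≤ L(h)` and
`|supp h♭| ≤ |supp (top_w h)|` over `ℝ≥0`: `P(per_G) = per_b` (`stub_blockSubstFacePer`), initial
forms are free and multiplicative (`complexity_topComponent_le`, `topComponent_mul`,
`topComponent_perPoly_eq_facePer`), projections are free (`complexity_le_of_isProjection`,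
`isProjection_blockSubst`), and `P` maps monomials to monomials with the same (nonzero)
coefficients. [folklore] -/
theorem stub_descentAt :
    ∀ (b k m n : ℕ) (eR eC : BlockV b k m ≃ Fin n) (w : Fin n × Fin n → ℕ)
      (h : MvPolynomial (Fin n × Fin n) ℝ≥0), CutsOut w (placedBlock eR eC) → h ≠ 0 →
      aeval (blockSubst eR eC) (topComponent w h) ≠ 0 ∧
      complexity (perPoly (Fin b) ℝ≥0 * aeval (blockSubst eR eC) (topComponent w h)) ≤
        complexity (perPoly (Fin n) ℝ≥0 * h) ∧
      complexity (aeval (blockSubst eR eC) (topComponent w h)) ≤ complexity h ∧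
      (aeval (blockSubst eR eC) (topComponent w h)).support.card ≤
        (topComponent w h).support.card := by
  intro b k m n eR eC w h hcut hh
  classical
  have hne : topComponent w h ≠ 0 := topComponent_ne_zero _ hh
  -- the image of the top fibre as a sum of monomials
  choose s hs using exists_blockSubst_eq_monomial_at eR eC
  set Φ : ((Fin n × Fin n) →₀ ℕ) → (Fin b × Fin b) →₀ ℕ :=
    fun d => ∑ e ∈ d.support, d e • s e
  have hsum : aeval (blockSubst eR eC) (topComponent w h) =
      ∑ d ∈ (topComponent w h).support, monomial (Φ d) (coeff d (topComponent w h)) := by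
    conv_lhs => rw [(topComponent w h).as_sum]
    rw [map_sum]
    exact Finset.sum_congr rfl fun d _ => aeval_monomial_eq_monomial_at hs d _
  refine ⟨?_, ?_, ?_, ?_⟩
  · -- `h♭ ≠ 0`: the coefficient of `x^{Φ d₀}`, `d₀ ∈ supp (top_w h)`, is `≥ coeff d₀ (top_w h) > 0`
    obtain ⟨d₀, hd₀⟩ := support_nonempty.mpr hne
    intro h0
    have hc := congrArg (coeff (Φ d₀)) h0
    rw [coeff_zero, hsum, coeff_sum] at hc
    have hle : coeff (Φ d₀) (monomial (Φ d₀) (coeff d₀ (topComponent w h))) ≤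
        ∑ d ∈ (topComponent w h).support,
          coeff (Φ d₀) (monomial (Φ d) (coeff d (topComponent w h))) :=
      Finset.single_le_sum_of_canonicallyOrdered
        (f := fun d => coeff (Φ d₀) (monomial (Φ d) (coeff d (topComponent w h)))) hd₀
    rw [hc, coeff_monomial, if_pos rfl, nonpos_iff_eq_zero] at hle
    exact (mem_support_iff.mp hd₀) hle
  · -- `L(per_b · h♭) ≤ L(per_n · h)`, via `per_b = P(per_G)`
    have h1 := complexity_topComponent_le w (perPoly (Fin n) ℝ≥0 * h)
    rw [topComponent_mul, topComponent_perPoly_eq_facePer hcut] at h1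
    have h2 := complexity_le_of_isProjection
      (isProjection_blockSubst eR eC (facePer (placedBlock eR eC) * topComponent w h))
    rw [map_mul, stub_blockSubstFacePer] at h2
    exact h2.trans h1
  · -- `L(h♭) ≤ L(h)`
    exact (complexity_le_of_isProjection (isProjection_blockSubst eR eC _)).trans
      (complexity_topComponent_le w h)
  · -- `|supp h♭| ≤ |supp (top_w h)|`
    rw [hsum]
    calc (∑ d ∈ (topComponent w h).support,
            monomial (Φ d) (coeff d (topComponent w h))).support.card
        ≤ ((topComponent w h).support.image Φ).card := by
          refine Finset.card_le_card fun x hx => ?_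
          obtain ⟨d, hd, hxd⟩ := Finset.mem_biUnion.mp (support_sum hx)
          exact Finset.mem_image.mpr
            ⟨d, hd, (Finset.mem_singleton.mp (support_monomial_subset hxd)).symm⟩
      _ ≤ (topComponent w h).support.card := Finset.card_image_le

end Summit.ValiantsHypothesis.ValiantsHypothesis.Theorems.DivisionGapPerDivisionHard

end
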